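import Literature.Analysis.Approximation.TuranNazarovZeroFree
import Mathlib.MeasureTheory.Covering.Vitali
import Mathlib.MeasureTheory.Measure.Lebesgue.Basic
import Mathlib.MeasureTheory.Integral.Layercake
import Mathlib.Analysis.SpecialFunctions.Stirling
import Mathlib.Analysis.SpecialFunctions.ImproperIntegrals
import Mathlib.Analysis.SpecialFunctions.Pow.Real
import Mathlib.Analysis.Complex.ExponentialBounds
import HarnessLib

/-!
# Turán–Nazarov inequality, proofs — Part 4: Cartan covering, sublevel sets, and the disk-growth Remez principle

Fourth file of the formalization of O. Friedland, *A disk-growth Remez principle and a modular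
proof of the measurable Turán–Nazarov inequality*, arXiv:2606.24823 (2026)
[Friedland2026DiskGrowthRemez], towards discharging
`Literature.Analysis.Approximation.TuranNazarov.lemma` (road map in
`Literature/Analysis/Approximation/TuranNazarovProofs.lean`).  Theorems only.

## Contents

* `cartan_line` — **Lemma A.4** (Cartan covering) on the real line, via Mathlib's Vitali covering
  lemma `Vitali.exists_disjoint_subfamily_covering_enlargement_closedBall`: off a measurable set of
  measure `≤ 2h`, fewer than `j` of the points `a_1,…,a_N` lie within `hj/(4N)`, for every `j ≥ 1`.
* `prod_lower_outside`, `prod_range_lower` — the ordered-distance consequence: outside that set,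
  `∏_{i ∈ T} min(1,|x-a_i|) ≥ ∏_{k<q} h(k+1)/(4N) ≥ h^q e^{-3N}` for `#T = q ≤ N` (Stirling's lower
  bound `Stirling.le_log_factorial_stirling` for `log q!`).
* `sublevel_estimate` — **Prop 2.2, sublevel part**: a lower bound
  `F(x) ≥ e^{-K} ∏_{i∈T(x)} min(1,|x - Re w_i|)` with `#T(x) ≤ d` on `I₀ = [-1/2,1/2]` gives
  `|{x ∈ I₀ : F(x) ≤ ε}| ≤ 4 e^{(K+3N)/d} ε^{1/d}`.
* `geometric_mean_bound` — **Prop 2.2, geometric-mean part** (layer-cake formula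
  `MeasureTheory.lintegral_eq_lintegral_meas_lt`): `0 ≤ F ≤ 1` on `I₀` with sublevel bound
  `A ε^{1/d}` ⟹ `log F ∈ L¹(E)` and `-(1/α)∫_E log F ≤ d log(A/α) + d` for measurable `E ⊆ I₀`,
  `|E| = α > 0`.
* `disk_growth_remez` — **Theorem 1.1** (disk-growth Remez principle, geometric-mean form) for an
  entire `f` with the ALL-SCALES disk growth `sup_{D̄(z₀,R)}|f| ≤ e^{aR+b}(R/r)^d sup_{D̄(z₀,r)}|f|`
  (the form `effective_zero_product` consumes): `log|f| ∈ L¹(E)` and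
  `sup_{I₀}|f| ≤ e^{2108(a+b+d)} α^{-d} exp(α⁻¹∫_E log|f|)`.  As printed: normalize
  `sup_{I₀}|f| = 1` (the case `f|_{I₀} ≡ 0` is trivial, so no identity theorem is needed),
  Prop 2.1, Prop 2.2; the finitely many real zeros (from `extract_zeros`) are a null set, which is
  the "harmless finite-set convention" of the paper (`Real.log 0 = 0`).
* `expsum_disk_growth_hyp`, `expsum_geometric_remez` — **Lemma 3.2 / Corollary 3.4** for
  exponential sums `∑_{k∈s} c_k e^{μ_k z}` with `#s = n ≥ 2`, `|μ_k| ≤ σ`: the disk-growth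
  hypothesis holds with `a = 2σ`, `b = (n-1)(1+log 4)`, `d = n-1`, whence
  `sup_{I₀}|p| ≤ e^{4216σ} (e^{7200}/α)^{n-1} exp(α⁻¹∫_E log|p|)`.
  Constants are explicit but not optimized.
-/

noncomputable section

open Complex Metric Set Real Filter Topology MeasureTheory

namespace Literature.Analysis.Approximation

namespace TuranNazarov

/-! ### Part 4a: Cartan's covering lemma on the line -/

/-- **Cartan covering on the line** (Friedland 2026, Lemma A.4, one-dimensional form, via the
Vitali covering lemma): given points `a_1,…,a_N ∈ ℝ` and `h > 0` there is a measurable set `Ω`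
of measure `≤ 2h` off which, for every `j ≥ 1`, fewer than `j` of the points lie at distance
`< hj/(4N)`. [cite: Friedland2026DiskGrowthRemez, Lemma A.4] -/
theorem cartan_line {N : ℕ} (a : Fin N → ℝ) {h : ℝ} (hh : 0 < h) :
    ∃ Ω : Set ℝ, MeasurableSet Ω ∧ volume Ω ≤ ENNReal.ofReal (2 * h) ∧
      ∀ x ∉ Ω, ∀ j : ℕ, 1 ≤ j →
        (Finset.univ.filter (fun i => |x - a i| < h * j / (4 * N))).card < j := by
  classical
  rcases Nat.eq_zero_or_pos N with hN0 | hNpos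
  · subst hN0
    refine ⟨∅, MeasurableSet.empty, by simp, fun x _ j hj => ?_⟩
    simp only [Finset.univ_eq_empty, Finset.filter_empty, Finset.card_empty]
    omega
  have hN : (0 : ℝ) < N := by exact_mod_cast hNpos
  -- the bad set and the radius function
  set cnt : ℝ → ℝ → ℕ := fun x r => (Finset.univ.filter (fun i => |x - a i| < r)).card with hcnt
  set bad : Set ℝ := {x | ∃ j : ℕ, 1 ≤ j ∧ j ≤ cnt x (h * j / (4 * N))} with hbad
  have hchoose : ∀ x ∈ bad, ∃ j : ℕ, 1 ≤ j ∧ j ≤ cnt x (h * j / (4 * N)) := fun x hx => hx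
  choose! J hJ1 hJ2 using hchoose
  set r : ℝ → ℝ := fun x => h * J x / (4 * N) with hr
  have hJN : ∀ x ∈ bad, J x ≤ N := by
    intro x hx
    have := hJ2 x hx
    exact this.trans ((Finset.card_filter_le _ _).trans (by simp))
  have hrle : ∀ x ∈ bad, r x ≤ h / 4 := by
    intro x hx
    simp only [hr]
    rw [div_le_div_iff₀ (by positivity) (by norm_num)]
    have : (J x : ℝ) ≤ N := by exact_mod_cast hJN x hx
    nlinarith
  have hrpos : ∀ x ∈ bad, 0 < r x := by
    intro x hx
    simp only [hr]
    have : (1 : ℝ) ≤ J x := by exact_mod_cast hJ1 x hx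
    positivity
  -- Vitali
  obtain ⟨u, hut, hdisj, hcov⟩ :=
    Vitali.exists_disjoint_subfamily_covering_enlargement_closedBall bad id r (h / 4) hrle 4
      (by norm_num)
  -- each selected ball contains at least `J y ≥ 1` of the points; the index sets are disjoint
  set S : ℝ → Finset (Fin N) := fun y => Finset.univ.filter (fun i => |y - a i| < r y) with hS
  have hScard : ∀ y ∈ u, J y ≤ (S y).card := fun y hy => hJ2 y (hut hy)
  have hSball : ∀ y i, i ∈ S y → a i ∈ closedBall (id y) (r y) := by
    intro y i hi
    rw [hS, Finset.mem_filter] at hi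
    rw [mem_closedBall, Real.dist_eq, abs_sub_comm]
    exact hi.2.le
  have hSdisj : ∀ y ∈ u, ∀ y' ∈ u, y ≠ y' → Disjoint (S y) (S y') := by
    intro y hy y' hy' hne
    rw [Finset.disjoint_left]
    intro i hi hi'
    exact Set.disjoint_left.1 (hdisj hy hy' hne) (hSball y i hi) (hSball y' i hi')
  -- `u` is finite
  have hpick : ∀ y ∈ u, ∃ i, i ∈ S y := by
    intro y hy
    have : 0 < (S y).card := lt_of_lt_of_le (hJ1 y (hut hy)) (hScard y hy)
    exact Finset.card_pos.1 this
  haveI : Nonempty (Fin N) := ⟨⟨0, hNpos⟩⟩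
  choose! pick hpick using hpick
  have hinj : InjOn pick u := by
    intro y hy y' hy' heq
    by_contra hne
    have := Finset.disjoint_left.1 (hSdisj y hy y' hy' hne) (hpick y hy)
    rw [heq] at this
    exact this (hpick y' hy')
  have hufin : u.Finite := Set.Finite.of_finite_image (Set.toFinite _) hinj
  set uF : Finset ℝ := hufin.toFinset with huF
  have huFmem : ∀ y, y ∈ uF ↔ y ∈ u := fun y => by simp [huF]
  -- the sum of the `J y`
  have hsumJ : (∑ y ∈ uF, (J y : ℝ)) ≤ N := by
    have h1 : ∑ y ∈ uF, J y ≤ ∑ y ∈ uF, (S y).card :=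
      Finset.sum_le_sum fun y hy => hScard y ((huFmem y).1 hy)
    have h2 : ∑ y ∈ uF, (S y).card = (uF.biUnion S).card := by
      rw [Finset.card_biUnion]
      intro y hy y' hy' hne
      exact hSdisj y ((huFmem y).1 hy) y' ((huFmem y').1 hy') hne
    have h3 : (uF.biUnion S).card ≤ N := (Finset.card_le_univ _).trans (by simp)
    have : ∑ y ∈ uF, J y ≤ N := by omega
    exact_mod_cast this
  -- the exceptional set
  set Ω : Set ℝ := ⋃ y ∈ uF, closedBall y (4 * r y) with hΩ
  refine ⟨Ω, ?_, ?_, ?_⟩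
  · exact MeasurableSet.biUnion uF.countable_toSet fun y _ => measurableSet_closedBall
  · calc volume Ω ≤ ∑ y ∈ uF, volume (closedBall y (4 * r y)) := measure_biUnion_finset_le _ _
      _ = ∑ y ∈ uF, ENNReal.ofReal (8 * r y) := by
          refine Finset.sum_congr rfl fun y _ => ?_
          rw [Real.volume_closedBall]; congr 1; ring
      _ = ENNReal.ofReal (∑ y ∈ uF, 8 * r y) := by
          rw [ENNReal.ofReal_sum_of_nonneg]
          intro y hy
          have := hrpos y (hut ((huFmem y).1 hy))
          positivity
      _ ≤ ENNReal.ofReal (2 * h) := by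
          apply ENNReal.ofReal_le_ofReal
          calc ∑ y ∈ uF, 8 * r y = (2 * h / N) * ∑ y ∈ uF, (J y : ℝ) := by
                rw [Finset.mul_sum]
                refine Finset.sum_congr rfl fun y _ => ?_
                simp only [hr]; field_simp; ring
            _ ≤ (2 * h / N) * N := by gcongr
            _ = 2 * h := by field_simp
  · intro x hx j hj
    by_contra hcon
    push Not at hcon
    have hxbad : x ∈ bad := ⟨j, hj, hcon⟩
    obtain ⟨y, hyu, hsub⟩ := hcov x hxbad
    apply hx
    rw [hΩ, Set.mem_iUnion₂]
    exact ⟨y, (huFmem y).2 hyu, hsub (mem_closedBall_self (hrpos x hxbad).le)⟩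

/-- Outside the Cartan set, a product over any `q` of the points is at least `∏_{k<q} h(k+1)/(4N)`
(remove the farthest point and induct). [cite: Friedland2026DiskGrowthRemez, Lemma A.4] -/
theorem prod_lower_outside {N : ℕ} (a : Fin N → ℝ) {h x : ℝ} (hh : 0 < h) (hh1 : h ≤ 1)
    (hx : ∀ j : ℕ, 1 ≤ j → (Finset.univ.filter (fun i => |x - a i| < h * j / (4 * N))).card < j)
    (q : ℕ) (T : Finset (Fin N)) (hT : T.card = q) :
    ∏ k ∈ Finset.range q, h * (k + 1) / (4 * N) ≤ ∏ i ∈ T, min 1 |x - a i| := by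
  classical
  induction q generalizing T with
  | zero => simp [Finset.card_eq_zero.1 hT]
  | succ q ih =>
    have hTne : T.Nonempty := by rw [← Finset.card_pos, hT]; omega
    obtain ⟨i₀, hi₀, hmax⟩ := Finset.exists_max_image T (fun i => |x - a i|) hTne
    have hN : (0 : ℝ) < N := by
      have : 0 < N := Fin.pos i₀
      exact_mod_cast this
    have hqN : q + 1 ≤ N := by rw [← hT]; exact (Finset.card_le_univ T).trans (by simp)
    -- the farthest point is at distance `≥ h(q+1)/(4N)`
    have hfar : h * (q + 1 : ℕ) / (4 * N) ≤ |x - a i₀| := by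
      by_contra hcon
      push Not at hcon
      have hsub : T ⊆ Finset.univ.filter (fun i => |x - a i| < h * (q + 1 : ℕ) / (4 * N)) := by
        intro i hi
        rw [Finset.mem_filter]
        exact ⟨Finset.mem_univ i, lt_of_le_of_lt (hmax i hi) hcon⟩
      have := Finset.card_le_card hsub
      have h2 := hx (q + 1) (by omega)
      omega
    have hr1 : h * (q + 1 : ℕ) / (4 * N) ≤ 1 := by
      rw [div_le_one (by positivity)]
      have : ((q + 1 : ℕ) : ℝ) ≤ N := by exact_mod_cast hqN
      nlinarith
    have hmin : h * (q + 1 : ℕ) / (4 * N) ≤ min 1 |x - a i₀| := le_min hr1 hfar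
    rw [Finset.prod_range_succ, ← Finset.mul_prod_erase T _ hi₀, mul_comm]
    have hcard : (T.erase i₀).card = q := by rw [Finset.card_erase_of_mem hi₀, hT]; simp
    push_cast at hmin
    exact mul_le_mul hmin (ih (T.erase i₀) hcard)
      (Finset.prod_nonneg fun k _ => by positivity) (le_min zero_le_one (abs_nonneg _))

/-- The numerical tail: `∏_{k<q} h(k+1)/(4N) ≥ h^q e^{-3N}` for `1 ≤ q ≤ N` (Stirling's lower bound
for `log q!` and `q log(N/q) ≤ N - q`). [folklore] -/
theorem prod_range_lower {N q : ℕ} {h : ℝ} (hh : 0 < h) (hq : 1 ≤ q) (hqN : q ≤ N) :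
    h ^ q * Real.exp (-(3 * N)) ≤ ∏ k ∈ Finset.range q, h * (k + 1) / (4 * N) := by
  have hN : (0 : ℝ) < N := by exact_mod_cast (lt_of_lt_of_le hq hqN)
  have hq0 : (0 : ℝ) < q := by exact_mod_cast hq
  have hpos : ∀ k ∈ Finset.range q, 0 < h * (k + 1) / (4 * N) := fun k _ => by positivity
  rw [← Real.exp_log (Finset.prod_pos hpos), ← Real.exp_log (pow_pos hh q), ← Real.exp_add,
    Real.exp_le_exp, Real.log_prod (fun k hk => (hpos k hk).ne')]
  have hterm : ∀ k ∈ Finset.range q, Real.log (h * (k + 1) / (4 * N)) =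
      Real.log h + Real.log (k + 1) - Real.log (4 * N) := by
    intro k _
    rw [Real.log_div (by positivity) (by positivity), Real.log_mul hh.ne' (by positivity)]
  rw [Finset.sum_congr rfl hterm, Finset.sum_sub_distrib, Finset.sum_add_distrib, Finset.sum_const,
    Finset.sum_const, Finset.card_range, nsmul_eq_mul, nsmul_eq_mul, Real.log_pow]
  -- `∑ log (k+1) = log q!`
  have hfact : ∑ k ∈ Finset.range q, Real.log ((k : ℝ) + 1) = Real.log (Nat.factorial q) := by
    rw [← Finset.prod_range_add_one_eq_factorial, Nat.cast_prod, Real.log_prod (fun k _ => by positivity)]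
    push_cast
    rfl
  rw [hfact]
  have hst := Stirling.le_log_factorial_stirling (n := q) (by omega)
  have hlogq : 0 ≤ Real.log q := Real.log_nonneg (by exact_mod_cast hq)
  have hlog2π : 0 ≤ Real.log (2 * Real.pi) := Real.log_nonneg (by linarith [Real.two_le_pi])
  have hlog4N : Real.log (4 * N) = Real.log 4 + Real.log N := Real.log_mul (by norm_num) hN.ne'
  have hlog4 : Real.log 4 ≤ 2 := by
    have h2 := Real.log_le_sub_one_of_pos (by norm_num : (0:ℝ) < 2)
    have : Real.log 4 = Real.log 2 + Real.log 2 := by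
      rw [← Real.log_mul (by norm_num) (by norm_num)]; norm_num
    linarith
  have h4q : (q : ℝ) * Real.log 4 ≤ 2 * q := by nlinarith
  have hqN' : (q : ℝ) ≤ N := by exact_mod_cast hqN
  -- `q log (N/q) ≤ N - q`
  have hNq : q * (Real.log N - Real.log q) ≤ N - q := by
    rw [← Real.log_div hN.ne' hq0.ne']
    have := Real.log_le_sub_one_of_pos (div_pos hN hq0)
    calc q * Real.log (N / q) ≤ q * (N / q - 1) := by gcongr
      _ = N - q := by field_simp
  rw [hlog4N]
  linarith [hst, hNq, h4q, hlogq, hlog2π, hqN']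


/-! ### Part 4b: the sublevel estimate and the geometric mean (Friedland 2026, Prop 2.2) -/

/-- **Sublevel estimate** (Friedland 2026, Prop 2.2, first half): if on `I₀ = [-1/2,1/2]` the
function `F` is bounded below by `e^{-K}` times a product of at most `d` of the factors
`min(1,|x - Re w_i|)`, `i ≤ N`, then `|{x ∈ I₀ : F(x) ≤ ε}| ≤ 4 e^{(K+3N)/d} ε^{1/d}` for every
`ε > 0` (Cartan covering with `h = (2ε e^{K+3N})^{1/d}`). [cite: Friedland2026DiskGrowthRemez, Prop 2.2] -/
theorem sublevel_estimate {N d : ℕ} (w : Fin N → ℂ) (hd : 1 ≤ d) {K : ℝ} {F : ℝ → ℝ}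
    (hlow : ∀ x ∈ Icc (-1 / 2 : ℝ) (1 / 2), ∃ T : Finset (Fin N), T.card ≤ d ∧
      Real.exp (-K) * ∏ i ∈ T, min 1 |x - (w i).re| ≤ F x)
    {ε : ℝ} (hε : 0 < ε) :
    volume {x ∈ Icc (-1 / 2 : ℝ) (1 / 2) | F x ≤ ε} ≤
      ENNReal.ofReal (4 * Real.exp ((K + 3 * N) / d) * ε ^ (1 / d : ℝ)) := by
  classical
  have hd0 : (0 : ℝ) < d := by exact_mod_cast hd
  set h : ℝ := (2 * ε * Real.exp (K + 3 * N)) ^ (1 / d : ℝ) with hh_def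
  have hbase : 0 < 2 * ε * Real.exp (K + 3 * N) := by positivity
  have hh0 : 0 < h := Real.rpow_pos_of_pos hbase _
  have hhd : h ^ d = 2 * ε * Real.exp (K + 3 * N) := by
    rw [hh_def, ← Real.rpow_natCast, ← Real.rpow_mul hbase.le, one_div_mul_cancel hd0.ne',
      Real.rpow_one]
  have hbound : 2 * h ≤ 4 * Real.exp ((K + 3 * N) / d) * ε ^ (1 / d : ℝ) := by
    have h1 : h = (2 : ℝ) ^ (1 / d : ℝ) * Real.exp ((K + 3 * N) / d) * ε ^ (1 / d : ℝ) := by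
      rw [hh_def, Real.mul_rpow (by positivity) (Real.exp_pos _).le,
        Real.mul_rpow (by norm_num) hε.le, ← Real.exp_mul, mul_one_div]
      ring
    have h2 : (2 : ℝ) ^ (1 / d : ℝ) ≤ 2 := by
      calc (2 : ℝ) ^ (1 / d : ℝ) ≤ (2 : ℝ) ^ (1 : ℝ) := by
            apply Real.rpow_le_rpow_of_exponent_le (by norm_num)
            rw [div_le_one hd0]; exact_mod_cast hd
        _ = 2 := Real.rpow_one 2
    rw [h1]
    have : 0 ≤ Real.exp ((K + 3 * N) / d) * ε ^ (1 / d : ℝ) := by positivity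
    nlinarith
  rcases le_or_gt h 1 with hh1 | hh1
  · -- Cartan covering at scale `h`
    obtain ⟨Ω, -, hΩvol, hΩ⟩ := cartan_line (fun i => (w i).re) hh0
    have hsub : {x ∈ Icc (-1 / 2 : ℝ) (1 / 2) | F x ≤ ε} ⊆ Ω := by
      intro x hx
      rw [Set.mem_setOf_eq] at hx
      by_contra hxΩ
      obtain ⟨T, hTd, hTlow⟩ := hlow x hx.1
      have hP := prod_lower_outside (fun i => (w i).re) hh0 hh1 (hΩ x hxΩ) T.card T rfl
      -- the product over `T` is at least `h^d e^{-3N}`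
      have hTN : T.card ≤ N := (Finset.card_le_univ T).trans (by simp)
      have hprod : h ^ d * Real.exp (-(3 * N)) ≤ ∏ i ∈ T, min 1 |x - (w i).re| := by
        rcases Nat.eq_zero_or_pos T.card with h0 | hTpos
        · rw [Finset.card_eq_zero.1 h0, Finset.prod_empty]
          calc h ^ d * Real.exp (-(3 * N)) ≤ 1 * 1 := by
                apply mul_le_mul (pow_le_one₀ hh0.le hh1) _ (Real.exp_pos _).le zero_le_one
                rw [Real.exp_le_one_iff]
                have : (0 : ℝ) ≤ N := Nat.cast_nonneg N
                linarith
            _ = 1 := one_mul 1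
        · calc h ^ d * Real.exp (-(3 * N)) ≤ h ^ T.card * Real.exp (-(3 * N)) :=
                mul_le_mul_of_nonneg_right (pow_le_pow_of_le_one hh0.le hh1 hTd) (Real.exp_pos _).le
            _ ≤ ∏ k ∈ Finset.range T.card, h * (k + 1) / (4 * N) :=
                prod_range_lower hh0 hTpos hTN
            _ ≤ _ := hP
      have : 2 * ε ≤ F x := by
        calc 2 * ε = Real.exp (-K) * (h ^ d * Real.exp (-(3 * N))) := by
              rw [hhd]
              have : Real.exp (-K) * (2 * ε * Real.exp (K + 3 * N) * Real.exp (-(3 * N))) =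
                  2 * ε * (Real.exp (-K) * Real.exp (K + 3 * N) * Real.exp (-(3 * N))) := by ring
              rw [this, ← Real.exp_add, ← Real.exp_add,
                show -K + (K + 3 * (N : ℝ)) + -(3 * (N : ℝ)) = 0 by ring, Real.exp_zero, mul_one]
          _ ≤ Real.exp (-K) * ∏ i ∈ T, min 1 |x - (w i).re| := by gcongr
          _ ≤ F x := hTlow
      linarith [hx.2]
    calc volume {x ∈ Icc (-1 / 2 : ℝ) (1 / 2) | F x ≤ ε} ≤ volume Ω := measure_mono hsub
      _ ≤ ENNReal.ofReal (2 * h) := hΩvol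
      _ ≤ _ := ENNReal.ofReal_le_ofReal hbound
  · -- `h > 1`: the trivial bound
    calc volume {x ∈ Icc (-1 / 2 : ℝ) (1 / 2) | F x ≤ ε} ≤ volume (Icc (-1 / 2 : ℝ) (1 / 2)) :=
          measure_mono fun x hx => hx.1
      _ = ENNReal.ofReal 1 := by rw [Real.volume_Icc]; norm_num
      _ ≤ _ := ENNReal.ofReal_le_ofReal (by linarith)


/-- **From sublevel estimates to geometric means** (Friedland 2026, Prop 2.2, second half;
layer-cake formula): if `0 ≤ F ≤ 1` on `I₀` and `|{x ∈ I₀ : F ≤ ε}| ≤ A ε^{1/d}` for all `ε > 0`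
(`A ≥ 1`), then for measurable `E ⊆ I₀` of measure `α > 0`, `log F` is integrable on `E` and
`-(1/α)∫_E log F ≤ d log(A/α) + d`. [cite: Friedland2026DiskGrowthRemez, Prop 2.2] -/
theorem geometric_mean_bound {d : ℕ} (hd : 1 ≤ d) {A : ℝ} (hA : 1 ≤ A) {F : ℝ → ℝ}
    (hFm : Measurable F) (hF0 : ∀ x ∈ Icc (-1 / 2 : ℝ) (1 / 2), 0 ≤ F x)
    (hF1 : ∀ x ∈ Icc (-1 / 2 : ℝ) (1 / 2), F x ≤ 1)
    (hsub : ∀ ε : ℝ, 0 < ε → volume {x ∈ Icc (-1 / 2 : ℝ) (1 / 2) | F x ≤ ε} ≤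
      ENNReal.ofReal (A * ε ^ (1 / d : ℝ)))
    {E : Set ℝ} (hEm : MeasurableSet E) (hE : E ⊆ Icc (-1 / 2 : ℝ) (1 / 2))
    (hEpos : 0 < (volume E).toReal) :
    IntegrableOn (fun x => Real.log (F x)) E ∧
      -(∫ x in E, Real.log (F x)) ≤
        (volume E).toReal * (d * Real.log (A / (volume E).toReal) + d) := by
  set α : ℝ := (volume E).toReal with hα
  have hd0 : (0 : ℝ) < d := by exact_mod_cast hd
  have hEle : volume E ≤ 1 := by
    calc volume E ≤ volume (Icc (-1 / 2 : ℝ) (1 / 2)) := measure_mono hE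
      _ = 1 := by rw [Real.volume_Icc]; norm_num
  have hEfin : volume E ≠ ⊤ := ne_top_of_le_ne_top ENNReal.one_ne_top hEle
  have hα1 : α ≤ 1 := by
    have := ENNReal.toReal_mono ENNReal.one_ne_top hEle
    simpa [hα] using this
  have hαvol : volume E = ENNReal.ofReal α := (ENNReal.ofReal_toReal hEfin).symm
  -- the nonnegative function `Y = -log F`
  set Y : ℝ → ℝ := fun x => -Real.log (F x) with hY
  have hYm : Measurable Y := (Real.measurable_log.comp hFm).neg
  have hY0 : ∀ x ∈ Icc (-1 / 2 : ℝ) (1 / 2), 0 ≤ Y x := fun x hx => by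
    simp only [hY, neg_nonneg]
    exact Real.log_nonpos (hF0 x hx) (hF1 x hx)
  set μ : Measure ℝ := volume.restrict E with hμ
  have hY0ae : 0 ≤ᵐ[μ] Y := by
    rw [hμ, EventuallyLE, ae_restrict_iff' hEm]
    exact Eventually.of_forall fun x hx => hY0 x (hE hx)
  -- layer cake
  have hcake := lintegral_eq_lintegral_meas_lt μ hY0ae hYm.aemeasurable
  -- bound on the distribution function
  have hdist : ∀ t : ℝ, 0 < t →
      μ {x | t < Y x} ≤ min (ENNReal.ofReal α) (ENNReal.ofReal (A * Real.exp (-t / d))) := by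
    intro t ht
    have h1 : μ {x | t < Y x} = volume ({x | t < Y x} ∩ E) := by
      rw [hμ, Measure.restrict_apply' hEm]
    rw [h1]
    refine le_min ?_ ?_
    · rw [← hαvol]; exact measure_mono Set.inter_subset_right
    · have hsub' : {x | t < Y x} ∩ E ⊆ {x ∈ Icc (-1 / 2 : ℝ) (1 / 2) | F x ≤ Real.exp (-t)} := by
        rintro x ⟨hx1, hx2⟩
        refine ⟨hE hx2, ?_⟩
        simp only [Set.mem_setOf_eq, hY] at hx1
        rcases (hF0 x (hE hx2)).eq_or_lt with h0 | hpos
        · rw [← h0]; exact (Real.exp_pos _).le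
        · rw [← Real.exp_log hpos]
          exact Real.exp_le_exp.2 (by linarith)
      calc volume ({x | t < Y x} ∩ E) ≤ volume {x ∈ Icc (-1 / 2 : ℝ) (1 / 2) | F x ≤ Real.exp (-t)} :=
            measure_mono hsub'
        _ ≤ ENNReal.ofReal (A * Real.exp (-t) ^ (1 / d : ℝ)) := hsub _ (Real.exp_pos _)
        _ = ENNReal.ofReal (A * Real.exp (-t / d)) := by
            rw [← Real.exp_mul]; congr 2; ring
  -- split the `t`-integral at `s₀ = d log (A/α)`
  set s₀ : ℝ := d * Real.log (A / α) with hs₀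
  have hAα : 1 ≤ A / α := by rw [le_div_iff₀ hEpos]; linarith
  have hs₀0 : 0 ≤ s₀ := mul_nonneg hd0.le (Real.log_nonneg hAα)
  have hexp_s₀ : A * Real.exp (-s₀ / d) = α := by
    rw [hs₀, show -(↑d * Real.log (A / α)) / ↑d = -Real.log (A / α) by field_simp, Real.exp_neg,
      Real.exp_log (by positivity)]
    field_simp
  have hI1 : ∫⁻ t in Ioc 0 s₀, μ {x | t < Y x} ≤ ENNReal.ofReal (α * s₀) := by
    calc ∫⁻ t in Ioc 0 s₀, μ {x | t < Y x} ≤ ∫⁻ _t in Ioc 0 s₀, ENNReal.ofReal α := by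
          apply setLIntegral_mono' measurableSet_Ioc
          intro t ht
          exact (hdist t ht.1).trans (min_le_left _ _)
      _ = ENNReal.ofReal α * volume (Ioc 0 s₀) := setLIntegral_const _ _
      _ = ENNReal.ofReal (α * s₀) := by
          rw [Real.volume_Ioc, sub_zero, ← ENNReal.ofReal_mul hEpos.le]
  have hint : IntegrableOn (fun t : ℝ => A * Real.exp (-t / d)) (Ioi s₀) := by
    have := (integrableOn_exp_mul_Ioi (a := -(1 / d)) (by rw [neg_lt_zero]; positivity) s₀).const_mul A
    refine (integrableOn_congr_fun (fun t _ => ?_) measurableSet_Ioi).1 this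
    show A * Real.exp (-(1 / (d : ℝ)) * t) = A * Real.exp (-t / d)
    rw [show -(1 / (d : ℝ)) * t = -t / d by ring]
  have hI2 : ∫⁻ t in Ioi s₀, μ {x | t < Y x} ≤ ENNReal.ofReal (d * α) := by
    calc ∫⁻ t in Ioi s₀, μ {x | t < Y x} ≤ ∫⁻ t in Ioi s₀, ENNReal.ofReal (A * Real.exp (-t / d)) := by
          apply setLIntegral_mono' measurableSet_Ioi
          intro t ht
          exact (hdist t (lt_of_le_of_lt hs₀0 ht)).trans (min_le_right _ _)
      _ = ENNReal.ofReal (∫ t in Ioi s₀, A * Real.exp (-t / d)) := by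
          rw [ofReal_integral_eq_lintegral_ofReal hint]
          exact Eventually.of_forall fun t => by positivity
      _ = ENNReal.ofReal (d * α) := by
          congr 1
          have h1 : ∫ t in Ioi s₀, A * Real.exp (-t / d) = A * ∫ t in Ioi s₀, Real.exp (-(1 / d) * t) := by
            rw [← integral_const_mul]
            refine setIntegral_congr_fun measurableSet_Ioi fun t _ => ?_
            show A * Real.exp (-t / d) = A * Real.exp (-(1 / (d : ℝ)) * t)
            rw [show -(1 / (d : ℝ)) * t = -t / d by ring]
          rw [h1, integral_exp_mul_Ioi (by rw [neg_lt_zero]; positivity)]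
          have h2 : -(1 / (d : ℝ)) * s₀ = -s₀ / d := by ring
          rw [h2]
          calc A * (-Real.exp (-s₀ / d) / -(1 / d)) = d * (A * Real.exp (-s₀ / d)) := by
                field_simp
            _ = d * α := by rw [hexp_s₀]
  have hlint : ∫⁻ x, ENNReal.ofReal (Y x) ∂μ ≤ ENNReal.ofReal (α * s₀) + ENNReal.ofReal (d * α) := by
    rw [hcake, ← Ioc_union_Ioi_eq_Ioi hs₀0,
      lintegral_union measurableSet_Ioi (Set.Ioc_disjoint_Ioi le_rfl)]
    exact add_le_add hI1 hI2
  have hlint_top : ∫⁻ x, ENNReal.ofReal (Y x) ∂μ < ⊤ :=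
    lt_of_le_of_lt hlint (ENNReal.add_lt_top.2 ⟨ENNReal.ofReal_lt_top, ENNReal.ofReal_lt_top⟩)
  -- integrability and the value of the integral
  have hYint : Integrable Y μ :=
    ⟨hYm.aestronglyMeasurable, (hasFiniteIntegral_iff_ofReal hY0ae).2 hlint_top⟩
  have hintY : ∫ x, Y x ∂μ ≤ α * s₀ + d * α := by
    rw [integral_eq_lintegral_of_nonneg_ae hY0ae hYm.aestronglyMeasurable]
    have := ENNReal.toReal_mono
      (ENNReal.add_ne_top.2 ⟨ENNReal.ofReal_ne_top, ENNReal.ofReal_ne_top⟩) hlint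
    rwa [ENNReal.toReal_add ENNReal.ofReal_ne_top ENNReal.ofReal_ne_top,
      ENNReal.toReal_ofReal (by positivity), ENNReal.toReal_ofReal (by positivity)] at this
  have hlogint : IntegrableOn (fun x => Real.log (F x)) E := by
    have : (fun x => Real.log (F x)) = fun x => -Y x := by funext x; simp [hY]
    rw [this]
    exact hYint.neg
  refine ⟨hlogint, ?_⟩
  have : -(∫ x in E, Real.log (F x)) = ∫ x, Y x ∂μ := by
    rw [hμ, ← integral_neg]
  rw [this, hs₀] at *
  calc ∫ x, Y x ∂μ ≤ α * (d * Real.log (A / α)) + d * α := hintY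
    _ = α * (d * Real.log (A / α) + d) := by ring


/-! ### Part 4c: the disk-growth Remez principle (Thm 1.1) and bounded spectra (Cor 3.4) -/

/-- **Disk-growth Remez principle** (Friedland 2026, Thm 1.1, geometric-mean form, for an entire
function satisfying the all-scales disk-growth bound `|f| ≤ e^{aR+b}(R/r)^d sup_{D̄(z₀,r)}|f|` on
`D̄(z₀,R)`): for every measurable `E ⊆ I₀ = [-1/2,1/2]` of measure `α > 0`, `log|f|` is integrable
on `E` and `sup_{I₀}|f| ≤ e^{2108(a+b+d)} α^{-d} exp(α⁻¹∫_E log|f|)`.  (Proof as printed: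
normalize `sup_{I₀}|f| = 1`, Prop 2.1 = `effective_zero_product`, Prop 2.2 = `sublevel_estimate` +
`geometric_mean_bound`.) [cite: Friedland2026DiskGrowthRemez, Thm 1.1] -/
theorem disk_growth_remez {f : ℂ → ℂ} (hf : ∀ z, AnalyticAt ℂ f z)
    {a b : ℝ} {d : ℕ} (ha : 0 ≤ a) (hb : 0 ≤ b) (hd : 1 ≤ d)
    (hDG : ∀ (z₀ : ℂ) (r R S : ℝ), 0 < r → r ≤ R →
      (∀ ζ ∈ closedBall z₀ r, ‖f ζ‖ ≤ S) → ∀ z ∈ closedBall z₀ R,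
        ‖f z‖ ≤ Real.exp (a * R + b) * (R / r) ^ d * S)
    {E : Set ℝ} (hEm : MeasurableSet E) (hE : E ⊆ Icc (-1 / 2 : ℝ) (1 / 2))
    (hEpos : 0 < (volume E).toReal) :
    IntegrableOn (fun t : ℝ => Real.log ‖f t‖) E ∧
      ∀ t ∈ Icc (-1 / 2 : ℝ) (1 / 2), ‖f t‖ ≤
        Real.exp (2108 * (a + b + d)) * (volume E).toReal⁻¹ ^ d *
          Real.exp ((volume E).toReal⁻¹ * ∫ s in E, Real.log ‖f s‖) := by
  classical
  set α : ℝ := (volume E).toReal with hα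
  have hd0 : (1 : ℝ) ≤ d := by exact_mod_cast hd
  by_cases h0 : ∀ t ∈ Icc (-1 / 2 : ℝ) (1 / 2), f t = 0
  · refine ⟨?_, fun t ht => ?_⟩
    · refine integrableOn_zero.congr_fun (fun t htE => ?_) hEm
      simp [h0 t (hE htE)]
    · rw [h0 t ht, norm_zero]; positivity
  push Not at h0
  obtain ⟨x₁, hx₁, hfx₁⟩ := h0
  have hf0 : f ≠ 0 := fun h => hfx₁ (by simp [h])
  -- the maximum `M > 0` of `|f|` on `I₀`
  have hfcont : Continuous f := continuous_iff_continuousAt.2 fun z => (hf z).continuousAt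
  have hcontR : Continuous fun t : ℝ => ‖f t‖ :=
    continuous_norm.comp (hfcont.comp Complex.continuous_ofReal)
  obtain ⟨x₀, hx₀, hmax⟩ := isCompact_Icc.exists_isMaxOn ⟨x₁, hx₁⟩ hcontR.continuousOn
  set M : ℝ := ‖f x₀‖ with hM
  have hmax' : ∀ t ∈ Icc (-1 / 2 : ℝ) (1 / 2), ‖f t‖ ≤ M := fun t ht => hmax ht
  have hM0 : 0 < M := lt_of_lt_of_le (norm_pos_iff.2 hfx₁) (hmax' x₁ hx₁)
  -- the normalized function `g = f / M`
  set g : ℂ → ℂ := fun z => (M : ℂ)⁻¹ * f z with hg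
  have hng : ∀ z, ‖g z‖ = M⁻¹ * ‖f z‖ := fun z => by
    simp only [hg, norm_mul, norm_inv, Complex.norm_real, Real.norm_eq_abs, abs_of_pos hM0]
  have hga : ∀ z, AnalyticAt ℂ g z := fun z => analyticAt_const.mul (hf z)
  have hgx₀ : ‖g x₀‖ = 1 := by rw [hng, ← hM, inv_mul_cancel₀ hM0.ne']
  have hg0 : g ≠ 0 := by
    intro h
    have h1 := hgx₀
    rw [h] at h1
    simp at h1
  have hDGg : ∀ (z₀ : ℂ) (r R S : ℝ), 0 < r → r ≤ R →
      (∀ ζ ∈ closedBall z₀ r, ‖g ζ‖ ≤ S) → ∀ z ∈ closedBall z₀ R,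
        ‖g z‖ ≤ Real.exp (a * R + b) * (R / r) ^ d * S := by
    intro z₀ r R S hr hrR hS z hz
    have hS' : ∀ ζ ∈ closedBall z₀ r, ‖f ζ‖ ≤ M * S := fun ζ hζ => by
      have := hS ζ hζ
      rwa [hng, inv_mul_le_iff₀ hM0] at this
    have := hDG z₀ r R (M * S) hr hrR hS' z hz
    rw [hng, inv_mul_le_iff₀ hM0]
    calc ‖f z‖ ≤ Real.exp (a * R + b) * (R / r) ^ d * (M * S) := this
      _ = M * (Real.exp (a * R + b) * (R / r) ^ d * S) := by ring
  have hone : ∃ x : ℝ, x ∈ Icc (-1 / 2 : ℝ) (1 / 2) ∧ 1 ≤ ‖g x‖ := ⟨x₀, hx₀, hgx₀.ge⟩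
  obtain ⟨N, w, hN, hlow⟩ := effective_zero_product hga hg0 ha hb hd hDGg hone
  -- Prop 2.2: sublevel estimate and geometric mean bound for `F = |g|` on the real line
  set F : ℝ → ℝ := fun x => ‖g x‖ with hF
  set K : ℝ := 2000 * (a + b + d) with hK
  set A : ℝ := 4 * Real.exp ((K + 3 * N) / d) with hA
  have hA1 : 1 ≤ A := by
    have h1 : 1 ≤ Real.exp ((K + 3 * N) / d) := Real.one_le_exp (by positivity)
    rw [hA]; linarith
  have hFc : Continuous F :=
    continuous_norm.comp ((continuous_const.mul hfcont).comp Complex.continuous_ofReal)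
  have hF0 : ∀ x ∈ Icc (-1 / 2 : ℝ) (1 / 2), 0 ≤ F x := fun x _ => norm_nonneg _
  have hF1 : ∀ x ∈ Icc (-1 / 2 : ℝ) (1 / 2), F x ≤ 1 := fun x hx => by
    simp only [hF]
    rw [hng, inv_mul_le_iff₀ hM0, mul_one]
    exact hmax' x hx
  have hsub' : ∀ ε : ℝ, 0 < ε → volume {x ∈ Icc (-1 / 2 : ℝ) (1 / 2) | F x ≤ ε} ≤
      ENNReal.ofReal (A * ε ^ (1 / d : ℝ)) := fun ε hε =>
    sublevel_estimate w hd (K := K) (F := F) hlow hε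
  obtain ⟨hlogF, hintF⟩ := geometric_mean_bound hd hA1 hFc.measurable hF0 hF1 hsub' hEm hE hEpos
  -- the real zeros of `f` in `I₀` form a finite (hence null) set
  obtain ⟨Z, _, _, hZiff, -, -, -, -, -⟩ := extract_zeros hf hf0 0 (ρ := 2) (R₀ := 3) (by norm_num)
  set Zr : Set ℝ := {t : ℝ | f t = 0 ∧ t ∈ Icc (-1 / 2 : ℝ) (1 / 2)} with hZr
  have hZr_fin : Zr.Finite := by
    have h1 : Zr ⊆ Complex.ofReal ⁻¹' (↑Z : Set ℂ) := by
      rintro t ⟨ht0, ht⟩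
      show (t : ℂ) ∈ (↑Z : Set ℂ)
      rw [Finset.mem_coe, hZiff]
      refine ⟨ht0, ?_⟩
      rw [mem_closedBall, dist_zero_right, Complex.norm_real, Real.norm_eq_abs, abs_le]
      constructor <;> linarith [ht.1, ht.2]
    exact (Z.finite_toSet.preimage Complex.ofReal_injective.injOn).subset h1
  have hae : ∀ᵐ t : ℝ ∂(volume.restrict E), Real.log ‖f t‖ = Real.log (F t) + Real.log M := by
    rw [ae_restrict_iff' hEm]
    have : ∀ᵐ t ∂(volume : Measure ℝ), t ∉ Zr :=
      measure_eq_zero_iff_ae_notMem.1 (hZr_fin.measure_zero volume)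
    filter_upwards [this] with t ht htE
    have hft : f t ≠ 0 := fun h => ht ⟨h, hE htE⟩
    simp only [hF]
    rw [hng, Real.log_mul (inv_ne_zero hM0.ne') (norm_ne_zero_iff.2 hft), Real.log_inv]
    ring
  have hEfin : volume E ≠ ⊤ := by
    intro h; rw [hα, h, ENNReal.toReal_top] at hEpos; exact lt_irrefl _ hEpos
  have hconst : IntegrableOn (fun _ : ℝ => Real.log M) E := integrableOn_const hEfin
  have hlogf : IntegrableOn (fun t : ℝ => Real.log ‖f t‖) E :=
    Integrable.congr (hlogF.add hconst) (hae.mono fun t ht => ht.symm)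
  have hint_eq : ∫ t in E, Real.log ‖f t‖ = (∫ t in E, Real.log (F t)) + α * Real.log M := by
    rw [integral_congr_ae hae, integral_add hlogF hconst, setIntegral_const, smul_eq_mul]
    rfl
  refine ⟨hlogf, fun t ht => ?_⟩
  -- bookkeeping of constants
  have hN0 : (0 : ℝ) ≤ N := Nat.cast_nonneg N
  have hlog4 : Real.log 4 ≤ 7 / 5 := by
    have : Real.log 4 = 2 * Real.log 2 := by
      rw [show (4 : ℝ) = 2 ^ 2 by norm_num, Real.log_pow]; norm_num
    rw [this]; linarith [Real.log_two_lt_d9]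
  have hlogA : Real.log (A / α) = Real.log 4 + (K + 3 * N) / d - Real.log α := by
    rw [Real.log_div (by positivity) hEpos.ne', hA, Real.log_mul (by norm_num) (Real.exp_pos _).ne',
      Real.log_exp]
  have h2 : (d : ℝ) * ((K + 3 * N) / d) = K + 3 * N := mul_div_cancel₀ _ (by positivity)
  have h3 : (d : ℝ) * Real.log (A / α) + d =
      d * Real.log 4 + (K + 3 * N) - d * Real.log α + d := by
    rw [hlogA, mul_sub, mul_add, h2]
  have h1 : -(α⁻¹ * ∫ x in E, Real.log (F x)) ≤ d * Real.log (A / α) + d := by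
    rw [← mul_neg, inv_mul_le_iff₀ hEpos]; exact hintF
  have hdl : (d : ℝ) * Real.log 4 ≤ d * (7 / 5) := by gcongr
  have hkey : 0 ≤ 2108 * (a + b + d) + -(d * Real.log α) + α⁻¹ * ∫ x in E, Real.log (F x) := by
    rw [h3] at h1
    rw [hK] at h1
    linarith only [h1, hN, hdl, ha, hb, hd0, hN0]
  have e1 : Real.exp (-(d * Real.log α)) = α⁻¹ ^ d := by
    rw [Real.exp_neg, Real.exp_nat_mul, Real.exp_log hEpos, inv_pow]
  have e2 : Real.exp (α⁻¹ * ∫ s in E, Real.log ‖f s‖) =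
      Real.exp (α⁻¹ * ∫ x in E, Real.log (F x)) * M := by
    rw [hint_eq, mul_add, Real.exp_add, ← mul_assoc, inv_mul_cancel₀ hEpos.ne', one_mul,
      Real.exp_log hM0]
  calc ‖f t‖ ≤ M := hmax' t ht
    _ = 1 * M := (one_mul M).symm
    _ ≤ Real.exp (2108 * (a + b + d) + -(d * Real.log α) + α⁻¹ * ∫ x in E, Real.log (F x)) * M := by
        gcongr; exact Real.one_le_exp hkey
    _ = Real.exp (2108 * (a + b + d)) * α⁻¹ ^ d *
          Real.exp (α⁻¹ * ∫ s in E, Real.log ‖f s‖) := by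
        rw [e2, Real.exp_add, Real.exp_add, e1]; ring


/-- The all-scales disk-growth hypothesis of `disk_growth_remez` for an exponential sum with
`n` terms and frequencies of modulus `≤ σ`: `a = 2σ`, `b = (n-1)(1 + log 4)`, `d = n - 1`
(a rewriting of `disk_growth`, Friedland 2026 Lemma 3.2). [cite: Friedland2026DiskGrowthRemez, Lemma 3.2] -/
theorem expsum_disk_growth_hyp {ι : Type*} (s : Finset ι) (c μ : ι → ℂ) {σ : ℝ}
    (hσ : ∀ k ∈ s, ‖μ k‖ ≤ σ) :
    ∀ (z₀ : ℂ) (r R S : ℝ), 0 < r → r ≤ R →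
      (∀ ζ ∈ closedBall z₀ r, ‖∑ k ∈ s, c k * cexp (μ k * ζ)‖ ≤ S) →
      ∀ z ∈ closedBall z₀ R, ‖∑ k ∈ s, c k * cexp (μ k * z)‖ ≤
        Real.exp (2 * σ * R + ((s.card - 1 : ℕ) : ℝ) * (1 + Real.log 4)) *
          (R / r) ^ (s.card - 1) * S := by
  intro z₀ r R S hr hrR hS z hz
  have h := disk_growth s c μ hσ z₀ hr hrR hS hz
  have h4e : 4 * Real.exp 1 = Real.exp (1 + Real.log 4) := by
    rw [Real.exp_add, Real.exp_log (by norm_num)]; ring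
  rw [h4e, mul_pow, ← Real.exp_nat_mul, show σ * (2 * R) = 2 * σ * R by ring] at h
  rw [Real.exp_add]
  calc _ ≤ _ := h
    _ = _ := by ring

/-- **Bounded-spectrum geometric Remez bound** (Friedland 2026, Cor 3.4, for `n ≥ 2` terms, with
explicit constants): for an exponential sum `p` with `n ≥ 2` terms and frequencies of modulus `≤ σ`
and a measurable `E ⊆ I₀` of measure `α > 0`, `log|p|` is integrable on `E` and
`sup_{I₀}|p| ≤ e^{4216σ} (e^{7200}/α)^{n-1} exp(α⁻¹∫_E log|p|)`.
[cite: Friedland2026DiskGrowthRemez, Cor 3.4] -/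
theorem expsum_geometric_remez {ι : Type*} (s : Finset ι) (c μ : ι → ℂ) {σ : ℝ}
    (hσ : ∀ k ∈ s, ‖μ k‖ ≤ σ) (hn : 2 ≤ s.card)
    {E : Set ℝ} (hEm : MeasurableSet E) (hE : E ⊆ Icc (-1 / 2 : ℝ) (1 / 2))
    (hEpos : 0 < (volume E).toReal) :
    IntegrableOn (fun t : ℝ => Real.log ‖∑ k ∈ s, c k * cexp (μ k * t)‖) E ∧
      ∀ t ∈ Icc (-1 / 2 : ℝ) (1 / 2), ‖∑ k ∈ s, c k * cexp (μ k * t)‖ ≤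
        Real.exp (4216 * σ) * (Real.exp 7200 / (volume E).toReal) ^ (s.card - 1) *
          Real.exp ((volume E).toReal⁻¹ *
            ∫ x in E, Real.log ‖∑ k ∈ s, c k * cexp (μ k * x)‖) := by
  set α : ℝ := (volume E).toReal with hα
  set f : ℂ → ℂ := fun z => ∑ k ∈ s, c k * cexp (μ k * z) with hf
  have hdiff : Differentiable ℂ f := by rw [hf]; fun_prop
  have hfa : ∀ z, AnalyticAt ℂ f z := fun z => hdiff.analyticAt z
  obtain ⟨k₀, hk₀⟩ : s.Nonempty := Finset.card_pos.1 (by omega)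
  have hσ0 : 0 ≤ σ := (norm_nonneg _).trans (hσ k₀ hk₀)
  set d : ℕ := s.card - 1 with hd
  have hd1 : 1 ≤ d := by omega
  have hd0 : (0 : ℝ) ≤ d := Nat.cast_nonneg d
  have hlog4 : Real.log 4 ≤ 7 / 5 := by
    have : Real.log 4 = 2 * Real.log 2 := by
      rw [show (4 : ℝ) = 2 ^ 2 by norm_num, Real.log_pow]; norm_num
    rw [this]; linarith [Real.log_two_lt_d9]
  have hlog4' : 0 ≤ Real.log 4 := Real.log_nonneg (by norm_num)
  have hDG := expsum_disk_growth_hyp s c μ hσ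
  have key := disk_growth_remez hfa (a := 2 * σ) (b := (d : ℝ) * (1 + Real.log 4)) (d := d)
    (by positivity) (by positivity) hd1 hDG hEm hE hEpos
  refine ⟨key.1, fun t ht => ?_⟩
  have hexp : Real.exp (2108 * (2 * σ + d * (1 + Real.log 4) + d)) ≤
      Real.exp (4216 * σ) * Real.exp 7200 ^ d := by
    rw [← Real.exp_nat_mul, ← Real.exp_add]
    apply Real.exp_le_exp.2
    have : (d : ℝ) * (1 + Real.log 4) ≤ d * (12 / 5) := by gcongr; linarith
    linarith only [this, hd0]
  calc ‖f t‖ ≤ _ := key.2 t ht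
    _ ≤ Real.exp (4216 * σ) * Real.exp 7200 ^ d * α⁻¹ ^ d *
          Real.exp (α⁻¹ * ∫ x in E, Real.log ‖f x‖) := by gcongr
    _ = Real.exp (4216 * σ) * (Real.exp 7200 / α) ^ d *
          Real.exp (α⁻¹ * ∫ x in E, Real.log ‖f x‖) := by
        rw [div_eq_mul_inv, mul_pow]; ring


end TuranNazarov

end Literature.Analysis.Approximation
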